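import Literature.NumberTheory.GaloisRepresentations.ContinuousCorestriction
import Literature.NumberTheory.GaloisRepresentations.ContinuousH1AddHomAlgebraProofs
import HarnessLib

/-!
# `H¹(H, X) = lim→ H¹(Uₙ, X)` for a closed subgroup `H` of a profinite group — the injectivity half, in the
# `subgroupRep` / `resLe` currency of topological representations (Serre I §2.2 Prop. 8, degree `1`)

Topic `Literature/NumberTheory/GaloisRepresentations` (namespace `Literature.NumberTheory.GaloisRepresentations.SubgroupRepColimit`).
THEOREMS ONLY (no definition, no named fact, no instance, no `sorry`).  Companion of
`EllipticCurves/SubgroupH1ClosedSubgroupColimit` (same statement in the `subgroupH1`/`resOfLe` currency of a discrete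
`DistribMulAction`): here the coefficients are an arbitrary topological representation `X : TopRep R G` with DISCRETE carrier and
open stabilizers (`hstab`), the layer groups are `continuousCohomology 1 (subgroupRep X Uₙ)` and the maps the tree's `resLe`.

* `exists_resLe_eq_zero` — for `Uₙ` open, antitone, above `H` and cofinal among the open neighbourhoods of `H`, a class of
  `H¹(Uₘ, X)` whose restriction to `H` vanishes already vanishes on some `Uₙ ≤ Uₘ` (the corrected cocycle vanishes on an
  open neighbourhood of `H`).

Written for cell `bsd-print-cf2` (seat cf2c-w8 g8, plug (π3) of ROW 1, LOCAL step: the tower of local groups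
`Λₙ = loc⁻¹(V̄ₙ) ≤ Γ_{K_v}` decreasing to `loc⁻¹(π(Gal(K̄/K̃_∞)))`).  HONEST FRAMING: topological group cohomology only.

## References
* J.-P. Serre, *Galois Cohomology* (1997), I §2.2 Proposition 8. [SerreGaloisCohomology1997]
* K. Rubin, *Euler Systems* (2000), App. B.2. [Rubin2000]
-/

noncomputable section

open CategoryTheory Topology

universe u v

namespace Literature.NumberTheory.GaloisRepresentations.SubgroupRepColimit

open Literature.NumberTheory.EllipticCurves (subgroupInclusion subgroupInclusion_apply_coe)

variable {R : Type u} [Ring R] [TopologicalSpace R]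
variable {G : Type v} [Group G] [TopologicalSpace G] [IsTopologicalGroup G] (X : TopRep.{v} R G)

/-- **Restriction on explicit classes vanishes iff the restricted cocycle is principal**:
`resLe X h 1 [φ] = 0 ↔ ∃ a, ∀ x ∈ H, φ x = ρ(x) a − a`. [cite: SerreGaloisCohomology1997, I §2.5 (restriction)] -/
theorem resLe_oneCocycleClass_eq_zero_iff {H H' : Subgroup G} (h : H ≤ H') (φ : contOneCocycles (subgroupRep X H')) :
    resLe X h 1 (oneCocycleClass _ φ) = 0 ↔ ∃ a : X, ∀ x : H, φ.1 (subgroupInclusion h x) = X.ρ (x : G) a - a := by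
  rw [resLe_oneCocycleClass, oneCocycleClass_eq_zero_iff]
  rfl

/-- With open stabilizers and discrete carrier, `g ↦ ρ(g) a` is continuous (constant on the cosets `g₀ · Stab(a)`).
[cite: SerreGaloisCohomology1997, I §2.1] -/
theorem continuous_apply_vec [DiscreteTopology X] (hstab : ∀ a : X, IsOpen {g : G | X.ρ g a = a}) (a : X) :
    Continuous fun g : G => X.ρ g a := by
  refine IsLocallyConstant.continuous ((IsLocallyConstant.iff_exists_open _).mpr fun g₀ => ?_)
  refine ⟨(fun g : G => g₀⁻¹ * g) ⁻¹' {g : G | X.ρ g a = a}, (hstab a).preimage (continuous_const_mul _),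
    by simp, fun g hg => ?_⟩
  have h : g = g₀ * (g₀⁻¹ * g) := by group
  have hg' : X.ρ (g₀⁻¹ * g) a = a := hg
  rw [h, map_mul]
  change X.ρ g₀ (X.ρ (g₀⁻¹ * g) a) = X.ρ g₀ a
  rw [hg']

/-- **INJECTIVITY half of Serre I §2.2 Prop. 8 in degree `1`, `subgroupRep` currency**: `Uₙ` open, antitone, above `H`, cofinal
among the open neighbourhoods of `H`; `X` discrete with open stabilizers; then a class of `H¹(Uₘ, X)` whose restriction to `H`
vanishes already vanishes on some `Uₙ ≤ Uₘ`. [cite: SerreGaloisCohomology1997, I §2.2 Prop. 8] [cite: Rubin2000, App. B.2] -/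
theorem exists_resLe_eq_zero [DiscreteTopology X] (hstab : ∀ a : X, IsOpen {g : G | X.ρ g a = a})
    {H : Subgroup G} (U : ℕ → Subgroup G) (hU : ∀ n, IsOpen (U n : Set G)) (hle : ∀ n, H ≤ U n) (hanti : Antitone U)
    (hcof : ∀ V : Set G, IsOpen V → (H : Set G) ⊆ V → ∃ n, (U n : Set G) ⊆ V)
    {m : ℕ} (y : continuousCohomology 1 (subgroupRep X (U m))) (hy : resLe X (hle m) 1 y = 0) :
    ∃ n, ∃ hmn : m ≤ n, resLe X (hanti hmn) 1 y = 0 := by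
  obtain ⟨z, rfl⟩ := oneCocycleClass_surjective _ y
  obtain ⟨a, ha⟩ := (resLe_oneCocycleClass_eq_zero_iff X (hle m) z).mp hy
  -- the open set where the corrected cocycle vanishes
  set O : Set G := Subtype.val '' {u : U m | z.1 u = X.ρ (u : G) a - a} with hO
  have hOo : IsOpen O := by
    refine (hU m).isOpenMap_subtype_val _ ?_
    have : {u : U m | z.1 u = X.ρ (u : G) a - a} = (fun u : U m => z.1 u - (X.ρ (u : G) a - a)) ⁻¹' {0} := by
      ext u
      simp only [Set.mem_setOf_eq, Set.mem_preimage, Set.mem_singleton_iff, sub_eq_zero]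
    rw [this]
    refine (isOpen_discrete _).preimage (z.1.continuous.sub ?_)
    exact ((continuous_apply_vec X hstab a).comp continuous_subtype_val).sub continuous_const
  have hHO : (H : Set G) ⊆ O := fun g hg => ⟨subgroupInclusion (hle m) ⟨g, hg⟩, ha ⟨g, hg⟩, rfl⟩
  obtain ⟨n₀, hn₀⟩ := hcof O hOo hHO
  refine ⟨max m n₀, le_max_left m n₀, (resLe_oneCocycleClass_eq_zero_iff X _ z).mpr ⟨a, fun x => ?_⟩⟩
  obtain ⟨u, hu, hux⟩ := hn₀ (hanti (le_max_right m n₀) x.2)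
  have hu' : u = subgroupInclusion (hanti (le_max_left m n₀)) x := Subtype.ext hux
  rw [hu'] at hu
  exact hu

/-- **Two layer classes with the same restriction to `H` agree on a deeper layer.** [cite: SerreGaloisCohomology1997, I §2.2 Prop. 8] -/
theorem exists_resLe_eq_resLe [DiscreteTopology X] (hstab : ∀ a : X, IsOpen {g : G | X.ρ g a = a})
    {H : Subgroup G} (U : ℕ → Subgroup G) (hU : ∀ n, IsOpen (U n : Set G)) (hle : ∀ n, H ≤ U n) (hanti : Antitone U)
    (hcof : ∀ V : Set G, IsOpen V → (H : Set G) ⊆ V → ∃ n, (U n : Set G) ⊆ V)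
    {m m' : ℕ} (y : continuousCohomology 1 (subgroupRep X (U m))) (y' : continuousCohomology 1 (subgroupRep X (U m')))
    (hyy' : resLe X (hle m) 1 y = resLe X (hle m') 1 y') :
    ∃ n, ∃ hmn : m ≤ n, ∃ hm'n : m' ≤ n, resLe X (hanti hmn) 1 y = resLe X (hanti hm'n) 1 y' := by
  set k := max m m' with hk
  have hd : resLe X (hle k) 1 (resLe X (hanti (le_max_left m m')) 1 y - resLe X (hanti (le_max_right m m')) 1 y') = 0 := by
    rw [map_sub, sub_eq_zero, resLe_resLe_apply, resLe_resLe_apply]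
    exact hyy'
  obtain ⟨n, hkn, hn⟩ := exists_resLe_eq_zero X hstab U hU hle hanti hcof _ hd
  refine ⟨n, (le_max_left m m').trans hkn, (le_max_right m m').trans hkn, ?_⟩
  rw [map_sub, sub_eq_zero, resLe_resLe_apply, resLe_resLe_apply] at hn
  exact hn

end Literature.NumberTheory.GaloisRepresentations.SubgroupRepColimit

end
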